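import Mathlib

/-!
# Route BalabanIR — crux 4R `BirGappedPhaseReductionR` (item `stmt-HubbardSuperconductivity-14846`):
# block-London coercivity V — trigonometric bookkeeping for the Fermi-strip stiffness estimate

Elementary inequalities for the local ("Fermi strip") analysis of the kernel structure factor
`S(q) = N⁻¹ Σ_k |f_k - f_{k+q}|²` of the `d+id` BdG reference (`f = Δ/E`,
`ξ(k) = -2cos k₀ - 2cos k₁ - μ`, `Δ(k) = 2Δ₁(cos k₀ - cos k₁) - 4iΔ₂ sin k₀ sin k₁`), hypothesis
(K1) of the kernel symbol inequality behind `bdgBlockLondonCoercivity_of_kernelSymbolIneq`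
(file `…BlockLondon`):
* `xiC_sub_eq`: the exact increment `ξ(k+v) - ξ(k) = Σᵢ 2 sin(kᵢ + vᵢ/2) · 2 sin(vᵢ/2)`;
* `xiC_sub_lower` / `xiC_sub_upper`: near a point where `σᵢ sin kᵢ ≈ S` the increment is
  `≈ 2S (σ₀u₀ + σ₁u₁)`, `uᵢ = 2 sin(vᵢ/2)`, up to `4r(|u₀| + |u₁|)`, and is at most `2(|u₀|+|u₁|)`;
* `deltaC_sub_norm_le`: `Δ` is Lipschitz, `|Δ(k') - Δ(k)| ≤ (2|Δ₁| + 4|Δ₂|)(|k'₀-k₀| + |k'₁-k₁|)`;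
* `two_sin_half_abs_le`, `abs_le_two_sin_half`: `(2/π)|v| ≤ |2 sin(v/2)| ≤ |v|` for `|v| ≤ π`;
* `norm_symbol_eq_phi`: `|Δ/E| = (1 + (ξ/|Δ|)²)^{-1/2}` (`Δ ≠ 0`);
* `phi_sub_ge`: `t ↦ (1+t²)^{-1/2}` is bi-Lipschitz from below on `[1/4, 3]`:
  `|t - t'| ≤ 260 |φ t - φ t'|`.
Pure trigonometry/algebra; no definition is introduced.
-/

noncomputable section

namespace Summit.HubbardSuperconductivity.HubbardSuperconductivity.Theorems

namespace BirBdG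

/-! ### The hopping symbol -/

/-- `cos a - cos (a + v) = 2 sin(a + v/2) sin(v/2)`. [folklore] -/
theorem cos_sub_cos_add (a v : ℝ) :
    Real.cos a - Real.cos (a + v) = Real.sin (a + v / 2) * (2 * Real.sin (v / 2)) := by
  rw [Real.cos_sub_cos]
  have h1 : (a + (a + v)) / 2 = a + v / 2 := by ring
  have h2 : (a - (a + v)) / 2 = -(v / 2) := by ring
  rw [h1, h2, Real.sin_neg]
  ring

/-- The exact increment of the hopping symbol `ξ(k) = -2cos k₀ - 2cos k₁ - μ`:
`ξ(k+v) - ξ(k) = Σᵢ 2 sin(kᵢ + vᵢ/2) · (2 sin(vᵢ/2))`. [folklore] -/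
theorem xiC_sub_eq (μ : ℝ) (k v : Fin 2 → ℝ) :
    (-2 * Real.cos ((k + v) 0) - 2 * Real.cos ((k + v) 1) - μ) -
        (-2 * Real.cos (k 0) - 2 * Real.cos (k 1) - μ) =
      2 * Real.sin (k 0 + v 0 / 2) * (2 * Real.sin (v 0 / 2)) +
        2 * Real.sin (k 1 + v 1 / 2) * (2 * Real.sin (v 1 / 2)) := by
  simp only [Pi.add_apply]
  have h0 := cos_sub_cos_add (k 0) (v 0)
  have h1 := cos_sub_cos_add (k 1) (v 1)
  linarith

/-- Lower bound on the hopping increment near a point with `σᵢ sin(kᵢ + vᵢ/2)` within `2r` of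
`S`: `2S|σ₀u₀ + σ₁u₁| - 4r(|u₀| + |u₁|) ≤ |ξ(k+v) - ξ(k)|`, `uᵢ = 2 sin(vᵢ/2)`. [folklore] -/
theorem xiC_sub_lower (μ S r : ℝ) (σ : Fin 2 → ℝ) (hσ : ∀ i, σ i = 1 ∨ σ i = -1)
    (k v : Fin 2 → ℝ) (hA : ∀ i, |σ i * Real.sin (k i + v i / 2) - S| ≤ 2 * r) :
    2 * S * |σ 0 * (2 * Real.sin (v 0 / 2)) + σ 1 * (2 * Real.sin (v 1 / 2))| -
        4 * r * (|2 * Real.sin (v 0 / 2)| + |2 * Real.sin (v 1 / 2)|) ≤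
      |(-2 * Real.cos ((k + v) 0) - 2 * Real.cos ((k + v) 1) - μ) -
        (-2 * Real.cos (k 0) - 2 * Real.cos (k 1) - μ)| := by
  rw [xiC_sub_eq]
  set u0 := 2 * Real.sin (v 0 / 2)
  set u1 := 2 * Real.sin (v 1 / 2)
  set A0 := σ 0 * Real.sin (k 0 + v 0 / 2)
  set A1 := σ 1 * Real.sin (k 1 + v 1 / 2)
  have hsq : ∀ i, σ i * σ i = 1 := fun i => by rcases hσ i with h | h <;> simp [h]
  -- `sin(kᵢ + vᵢ/2) = σᵢ Aᵢ`
  have e0 : Real.sin (k 0 + v 0 / 2) = σ 0 * A0 := by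
    simp only [A0]; rw [← mul_assoc, hsq 0, one_mul]
  have e1 : Real.sin (k 1 + v 1 / 2) = σ 1 * A1 := by
    simp only [A1]; rw [← mul_assoc, hsq 1, one_mul]
  rw [e0, e1]
  have key : 2 * (σ 0 * A0) * u0 + 2 * (σ 1 * A1) * u1 =
      2 * S * (σ 0 * u0 + σ 1 * u1) + (2 * (A0 - S) * (σ 0 * u0) + 2 * (A1 - S) * (σ 1 * u1)) := by ring
  rw [key]
  have hσabs : ∀ i, |σ i| = 1 := fun i => by rcases hσ i with h | h <;> simp [h]
  have hsu : ∀ (i : Fin 2) (x : ℝ), |σ i * x| = |x| := fun i x => by rw [abs_mul, hσabs i, one_mul]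
  have t0 : |2 * (A0 - S) * (σ 0 * u0)| = 2 * |A0 - S| * |u0| := by
    rw [abs_mul, abs_mul, abs_two, hsu]
  have t1 : |2 * (A1 - S) * (σ 1 * u1)| = 2 * |A1 - S| * |u1| := by
    rw [abs_mul, abs_mul, abs_two, hsu]
  have hrem : |2 * (A0 - S) * (σ 0 * u0) + 2 * (A1 - S) * (σ 1 * u1)| ≤ 4 * r * (|u0| + |u1|) := by
    have h := abs_add_le (2 * (A0 - S) * (σ 0 * u0)) (2 * (A1 - S) * (σ 1 * u1))
    rw [t0, t1] at h
    have b0 : 2 * |A0 - S| * |u0| ≤ 2 * (2 * r) * |u0| := by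
      have := hA 0
      gcongr
    have b1 : 2 * |A1 - S| * |u1| ≤ 2 * (2 * r) * |u1| := by
      have := hA 1
      gcongr
    linarith
  set X := 2 * S * (σ 0 * u0 + σ 1 * u1) with hX
  set Y := 2 * (A0 - S) * (σ 0 * u0) + 2 * (A1 - S) * (σ 1 * u1) with hY
  have h1 : |X| - |Y| ≤ |X + Y| := by
    have := abs_sub_abs_le_abs_sub X (-Y)
    rwa [abs_neg, sub_neg_eq_add] at this
  have h2 : |X| = 2 * |S| * |σ 0 * u0 + σ 1 * u1| := by rw [hX, abs_mul, abs_mul, abs_two]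
  have h3 : 2 * S * |σ 0 * u0 + σ 1 * u1| ≤ 2 * |S| * |σ 0 * u0 + σ 1 * u1| := by
    gcongr; exact le_abs_self S
  linarith

/-- Upper bound on the hopping increment: `|ξ(k+v) - ξ(k)| ≤ 2(|u₀| + |u₁|)`. [folklore] -/
theorem xiC_sub_upper (μ : ℝ) (k v : Fin 2 → ℝ) :
    |(-2 * Real.cos ((k + v) 0) - 2 * Real.cos ((k + v) 1) - μ) -
        (-2 * Real.cos (k 0) - 2 * Real.cos (k 1) - μ)| ≤
      2 * (|2 * Real.sin (v 0 / 2)| + |2 * Real.sin (v 1 / 2)|) := by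
  rw [xiC_sub_eq]
  have h0 := Real.abs_sin_le_one (k 0 + v 0 / 2)
  have h1 := Real.abs_sin_le_one (k 1 + v 1 / 2)
  have t0 : |2 * Real.sin (k 0 + v 0 / 2) * (2 * Real.sin (v 0 / 2))| =
      2 * |Real.sin (k 0 + v 0 / 2)| * |2 * Real.sin (v 0 / 2)| := by
    rw [abs_mul (2 * Real.sin (k 0 + v 0 / 2)), abs_mul 2, abs_two]
  have t1 : |2 * Real.sin (k 1 + v 1 / 2) * (2 * Real.sin (v 1 / 2))| =
      2 * |Real.sin (k 1 + v 1 / 2)| * |2 * Real.sin (v 1 / 2)| := by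
    rw [abs_mul (2 * Real.sin (k 1 + v 1 / 2)), abs_mul 2, abs_two]
  have h := abs_add_le (2 * Real.sin (k 0 + v 0 / 2) * (2 * Real.sin (v 0 / 2)))
    (2 * Real.sin (k 1 + v 1 / 2) * (2 * Real.sin (v 1 / 2)))
  rw [t0, t1] at h
  have b0 : 2 * |Real.sin (k 0 + v 0 / 2)| * |2 * Real.sin (v 0 / 2)| ≤ 2 * 1 * |2 * Real.sin (v 0 / 2)| := by
    gcongr
  have b1 : 2 * |Real.sin (k 1 + v 1 / 2)| * |2 * Real.sin (v 1 / 2)| ≤ 2 * 1 * |2 * Real.sin (v 1 / 2)| := by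
    gcongr
  linarith

/-! ### The chord `u = 2 sin(v/2)` versus `v` -/

/-- `|2 sin(v/2)| ≤ |v|`. [folklore] -/
theorem two_sin_half_abs_le (v : ℝ) : |2 * Real.sin (v / 2)| ≤ |v| := by
  rw [abs_mul, abs_two]
  have := Real.abs_sin_le_abs (x := v / 2)
  have hv : |v / 2| = |v| / 2 := by rw [abs_div, abs_two]
  linarith

/-- Jordan: `(2/π)|v| ≤ |2 sin(v/2)|` for `|v| ≤ π`. [folklore] -/
theorem abs_le_two_sin_half {v : ℝ} (hv : |v| ≤ Real.pi) :
    2 / Real.pi * |v| ≤ |2 * Real.sin (v / 2)| := by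
  have hπ := Real.pi_pos
  -- reduce to `0 ≤ v` by symmetry
  wlog h : 0 ≤ v generalizing v
  · have h' : 0 ≤ -v := by linarith [le_of_not_ge h]
    have := this (v := -v) (by rwa [abs_neg]) h'
    rwa [abs_neg, neg_div, Real.sin_neg, mul_neg, abs_neg] at this
  rw [abs_of_nonneg h] at hv ⊢
  have h1 : 0 ≤ v / 2 := by linarith
  have h2 : v / 2 ≤ Real.pi / 2 := by linarith
  have hj := Real.mul_le_sin h1 h2
  have hs : 0 ≤ Real.sin (v / 2) := Real.sin_nonneg_of_nonneg_of_le_pi h1 (by linarith)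
  rw [abs_of_nonneg (by linarith)]
  have : 2 / Real.pi * v = 2 * (2 / Real.pi * (v / 2)) := by ring
  rw [this]
  linarith

/-! ### The pairing symbol is Lipschitz -/

/-- `|sin a sin b - sin a' sin b'| ≤ |a - a'| + |b - b'|`. [folklore] -/
theorem abs_sin_mul_sin_sub_le (a b a' b' : ℝ) :
    |Real.sin a * Real.sin b - Real.sin a' * Real.sin b'| ≤ |a - a'| + |b - b'| := by
  have e : Real.sin a * Real.sin b - Real.sin a' * Real.sin b' =
      (Real.sin a - Real.sin a') * Real.sin b + Real.sin a' * (Real.sin b - Real.sin b') := by ring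
  rw [e]
  calc |(Real.sin a - Real.sin a') * Real.sin b + Real.sin a' * (Real.sin b - Real.sin b')|
      ≤ |(Real.sin a - Real.sin a') * Real.sin b| + |Real.sin a' * (Real.sin b - Real.sin b')| :=
        abs_add_le _ _
    _ = |Real.sin a - Real.sin a'| * |Real.sin b| + |Real.sin a'| * |Real.sin b - Real.sin b'| := by
        rw [abs_mul, abs_mul]
    _ ≤ |a - a'| * 1 + 1 * |b - b'| :=
        add_le_add (mul_le_mul (Real.abs_sin_sub_sin_le a a') (Real.abs_sin_le_one b)
            (abs_nonneg _) (abs_nonneg _))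
          (mul_le_mul (Real.abs_sin_le_one a') (Real.abs_sin_sub_sin_le b b')
            (abs_nonneg _) zero_le_one)
    _ = |a - a'| + |b - b'| := by ring

/-- **The `d+id` pairing symbol is Lipschitz**:
`|Δ(k') - Δ(k)| ≤ (2|Δ₁| + 4|Δ₂|)(|k'₀ - k₀| + |k'₁ - k₁|)`. [folklore] -/
theorem deltaC_sub_norm_le : ∀ (Δ₁ Δ₂ : ℝ) (k k' : Fin 2 → ℝ), ‖(((2 * Δ₁ * (Real.cos (k' 0) - Real.cos (k' 1)) : ℝ) : ℂ) - 4 * Complex.I * ((Δ₂ * Real.sin (k' 0) * Real.sin (k' 1) : ℝ) : ℂ)) - (((2 * Δ₁ * (Real.cos (k 0) - Real.cos (k 1)) : ℝ) : ℂ) - 4 * Complex.I * ((Δ₂ * Real.sin (k 0) * Real.sin (k 1) : ℝ) : ℂ))‖ ≤ (2 * |Δ₁| + 4 * |Δ₂|) * (|k' 0 - k 0| + |k' 1 - k 1|) := by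
  intro Δ₁ Δ₂ k k'
  set R : ℝ := 2 * Δ₁ * ((Real.cos (k' 0) - Real.cos (k 0)) - (Real.cos (k' 1) - Real.cos (k 1))) with hR
  set J : ℝ := 4 * Δ₂ * (Real.sin (k' 0) * Real.sin (k' 1) - Real.sin (k 0) * Real.sin (k 1)) with hJ
  have e : (((2 * Δ₁ * (Real.cos (k' 0) - Real.cos (k' 1)) : ℝ) : ℂ) -
        4 * Complex.I * ((Δ₂ * Real.sin (k' 0) * Real.sin (k' 1) : ℝ) : ℂ)) -
      (((2 * Δ₁ * (Real.cos (k 0) - Real.cos (k 1)) : ℝ) : ℂ) -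
        4 * Complex.I * ((Δ₂ * Real.sin (k 0) * Real.sin (k 1) : ℝ) : ℂ)) =
      (R : ℂ) - Complex.I * (J : ℂ) := by
    rw [hR, hJ]; push_cast; ring
  rw [e]
  have hn : ‖(R : ℂ) - Complex.I * (J : ℂ)‖ ≤ |R| + |J| := by
    calc ‖(R : ℂ) - Complex.I * (J : ℂ)‖ ≤ ‖(R : ℂ)‖ + ‖Complex.I * (J : ℂ)‖ := norm_sub_le _ _
      _ = |R| + |J| := by
          rw [norm_mul, Complex.norm_I, one_mul, Complex.norm_real, Complex.norm_real,
            Real.norm_eq_abs, Real.norm_eq_abs]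
  have hRb : |R| ≤ 2 * |Δ₁| * (|k' 0 - k 0| + |k' 1 - k 1|) := by
    rw [hR, abs_mul, abs_mul, abs_two]
    gcongr
    calc |Real.cos (k' 0) - Real.cos (k 0) - (Real.cos (k' 1) - Real.cos (k 1))|
        ≤ |Real.cos (k' 0) - Real.cos (k 0)| + |Real.cos (k' 1) - Real.cos (k 1)| := abs_sub _ _
      _ ≤ |k' 0 - k 0| + |k' 1 - k 1| :=
          add_le_add (Real.abs_cos_sub_cos_le _ _) (Real.abs_cos_sub_cos_le _ _)
  have hJb : |J| ≤ 4 * |Δ₂| * (|k' 0 - k 0| + |k' 1 - k 1|) := by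
    rw [hJ, abs_mul, abs_mul, show |(4 : ℝ)| = 4 by norm_num]
    gcongr
    exact abs_sin_mul_sin_sub_le _ _ _ _
  calc ‖(R : ℂ) - Complex.I * (J : ℂ)‖ ≤ |R| + |J| := hn
    _ ≤ 2 * |Δ₁| * (|k' 0 - k 0| + |k' 1 - k 1|) + 4 * |Δ₂| * (|k' 0 - k 0| + |k' 1 - k 1|) :=
        add_le_add hRb hJb
    _ = (2 * |Δ₁| + 4 * |Δ₂|) * (|k' 0 - k 0| + |k' 1 - k 1|) := by ring

/-! ### `|f| = φ(ξ/|Δ|)` and the lower bi-Lipschitz bound of `φ` -/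

/-- `|Δ| / √(ξ² + |Δ|²) = (1 + (ξ/|Δ|)²)^{-1/2}` for `Δ ≠ 0`. [folklore] -/
theorem norm_symbol_eq_phi (ξ : ℝ) (D : ℂ) (hD : D ≠ 0) :
    ‖D / ((Real.sqrt (ξ ^ 2 + ‖D‖ ^ 2) : ℝ) : ℂ)‖ = 1 / Real.sqrt (1 + (ξ / ‖D‖) ^ 2) := by
  have hDn : 0 < ‖D‖ := norm_pos_iff.2 hD
  have hpos : 0 < ξ ^ 2 + ‖D‖ ^ 2 := by positivity
  rw [norm_div, Complex.norm_real, Real.norm_of_nonneg (Real.sqrt_nonneg _)]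
  have h1 : 1 + (ξ / ‖D‖) ^ 2 = (ξ ^ 2 + ‖D‖ ^ 2) / ‖D‖ ^ 2 := by
    field_simp
    ring
  rw [h1, Real.sqrt_div' _ (by positivity), Real.sqrt_sq hDn.le]
  field_simp

/-- The profile `φ(t) = (1+t²)^{-1/2}` decreases at rate at least `1/260` on `[1/4, 3]`:
`t ≤ t'` there implies `(t' - t)/260 ≤ φ t - φ t'`. [folklore] -/
theorem phi_sub_ge {t t' : ℝ} (ht : 1 / 4 ≤ t) (ht' : t' ≤ 3) (htt' : t ≤ t') :
    (t' - t) / 260 ≤ 1 / Real.sqrt (1 + t ^ 2) - 1 / Real.sqrt (1 + t' ^ 2) := by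
  have ht0 : 0 < t := by linarith
  have ht'0 : 0 < t' := by linarith
  set a := Real.sqrt (1 + t ^ 2) with ha
  set b := Real.sqrt (1 + t' ^ 2) with hb
  have ha0 : 0 < a := Real.sqrt_pos.2 (by positivity)
  have hb0 : 0 < b := Real.sqrt_pos.2 (by positivity)
  have ha2 : a ^ 2 = 1 + t ^ 2 := Real.sq_sqrt (by positivity)
  have hb2 : b ^ 2 = 1 + t' ^ 2 := Real.sq_sqrt (by positivity)
  -- `a ≤ b ≤ 16/5` (`b² ≤ 10 < (16/5)²`)
  have hb4 : b ≤ 16 / 5 := by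
    rw [hb, Real.sqrt_le_left (by norm_num)]
    nlinarith
  have hab : a ≤ b := Real.sqrt_le_sqrt (by nlinarith)
  have ha4 : a ≤ 16 / 5 := hab.trans hb4
  -- `1/a - 1/b = (t'² - t²)/(ab(a+b))`
  have key : 1 / a - 1 / b = (t' - t) * (t' + t) / (a * b * (a + b)) := by
    field_simp
    nlinarith [ha2, hb2]
  rw [key, div_le_div_iff₀ (by norm_num) (by positivity)]
  have h1 : a * b * (a + b) ≤ 66 := by
    have : a * b ≤ 11 := by nlinarith
    nlinarith
  have h2 : (1 : ℝ) / 2 ≤ t' + t := by linarith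
  have hx : a * b * (a + b) ≤ 260 * (t' + t) := by linarith
  calc (t' - t) * (a * b * (a + b)) ≤ (t' - t) * (260 * (t' + t)) :=
        mul_le_mul_of_nonneg_left hx (sub_nonneg.2 htt')
    _ = (t' - t) * (t' + t) * 260 := by ring

end BirBdG

end Summit.HubbardSuperconductivity.HubbardSuperconductivity.Theorems

end
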